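import Literature.Analysis.Complex.ThricePuncturedSphereAutomorphisms
import Literature.Analysis.Calculus.PointPushDiffeomorphism
import Mathlib.NumberTheory.Transcendental.Liouville.LiouvilleNumber
import Mathlib.RingTheory.Localization.Integral
import HarnessLib

/-!
# [IUTchI] Rmk 3.4.3 (ii) at the genuine model: an `Aut^hol`-EQUIVARIANT self-homeomorphism of
# `ℂ ∖ {0,1}` that moves an NF-point off the NF-points (witness construction)

S. Mochizuki, *Inter-universal Teichmüller theory I*, §3, Remark 3.4.3 (ii), kurims p. 83: "the set of
NF-points … may be reconstructed via a functorial algorithm from the [abstract] Aut-holomorphic space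
`D_v`" [cite: Mochizuki2012, Rmk 3.4.3 (ii) p.83] [claim: Mochizuki2012, status: disputed].  The cell's
typing of this remark (`ThetaHodgeTheatersRemarksA2.lean`, abc-iut-L3-t8) records an Aut-holomorphic
space by ONE subgroup `autHol` of self-homeomorphisms and reads "functorial algorithm" as
`NFPointsFunctorial X Y`: every homeomorphism CONJUGATING `autHol` onto `autHol` carries NF-points onto
NF-points.  At the GENUINE model of `AutHolSpaceNFNonVacuity.lean` (the hyperbolic curve
`P¹_ℚ ∖ {0,1,∞}`: carrier `ℂ ∖ {0,1}`, `autHol = Aut^hol(ℂ ∖ {0,1})`, NF-points = `ℚ̄`-points) this group is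
FINITE — the anharmonic group `S₃` (`ThricePuncturedSphereAutomorphisms`, classical) — and this file
builds the witness against the typed reading (used by `AutHolSpaceNFFunctorialityNegative.lean`):

* `AutHolSpaceNFWitness.exists_equivariant_push` (in `…EquivariantPushMain.lean`) — a homeomorphism `α` of `U = ℂ ∖ {0,1}` COMMUTING WITH
  EVERY `φ ∈ holAut U` and moving the NF-point `3` to `3 + ξ/10`, `ξ = liouvilleNumber 10`
  (transcendental), hence off the NF-points.

Construction (Milnor's homogeneity lemma, equivariantly): the planar point-push
`β(z) = z + max(0, 1/10 - |z - 3|)·ξ` (tree: `Literature.Analysis.Calculus.pointPushHomeomorph`,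
[cite: Milnor1965, §4 Homogeneity Lemma]) is a homeomorphism of `ℂ` supported in the disc `B(3, 1/10)`;
the six discs `g(B)`, `g ∈ S₃ = ⟨z ↦ 1-z, z ↦ 1/z⟩`, are pairwise disjoint, so the product of the six
conjugates `g ∘ β ∘ g⁻¹` is an `S₃`-equivariant homeomorphism of `U`; by the classification
`eq_one_of_six` it commutes with all of `Aut^hol(U)`.  Proof-only file: no definitions.
-/

noncomputable section

namespace Literature.IUT.HodgeTheaters

namespace AutHolSpaceNFWitness

open Filter Topology Metric Set Function
open scoped Manifold ContDiff
open _root_.TopologicalSpace (Opens)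
open Literature.AnabelianGeometry.AbsoluteAnabelian Literature.Analysis.Calculus
open Literature.Analysis.Complex Literature.Analysis.Complex.ThricePunctured

variable {U : Opens ℂ} (hU : (U : Set ℂ) = {z | z ≠ 0 ∧ z ≠ 1})

/-! ### Products of homeomorphisms with pairwise disjoint supports -/

/-- A product of self-homeomorphisms with pairwise disjoint, invariant supports acts on a point of the
`i`-th support as the `i`-th factor, and trivially off all supports. (Used for the six conjugates of
the point-push.) [cite: Milnor1965, §4 Homogeneity Lemma] -/
theorem list_prod_apply {X ι : Type*} [TopologicalSpace X] (c : ι → X ≃ₜ X) (S : ι → Set X)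
    (hfix : ∀ i x, x ∉ S i → c i x = x) (hstab : ∀ i x, x ∈ S i → c i x ∈ S i)
    (hdisj : ∀ i j, i ≠ j → Disjoint (S i) (S j)) :
    ∀ (l : List ι), l.Nodup → ∀ x,
      (∀ i ∈ l, x ∈ S i → (l.map c).prod x = c i x) ∧ ((∀ i ∈ l, x ∉ S i) → (l.map c).prod x = x) := by
  intro l
  induction l with
  | nil => intro _ x; simp
  | cons a l ih =>
    intro hnd x
    rw [List.nodup_cons] at hnd
    obtain ⟨hal, hl⟩ := hnd
    have ih' := ih hl
    simp only [List.map_cons, List.prod_cons, Homeomorph.mul_apply, List.mem_cons]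
    constructor
    · rintro i (rfl | hi) hx
      · -- `i = a`: the tail fixes `x`
        have htail : (l.map c).prod x = x := (ih' x).2 fun j hj hxj =>
          (hdisj i j (fun h => hal (h ▸ hj))).le_bot ⟨hx, hxj⟩
        rw [htail]
      · -- `i ∈ l`: the tail acts as `c i`, and `c a` fixes `c i x ∈ S i`
        have hia : i ≠ a := fun h => hal (h ▸ hi)
        rw [(ih' x).1 i hi hx]
        exact hfix a _ fun h => (hdisj i a hia).le_bot ⟨hstab i x hx, h⟩
    · intro h
      rw [(ih' x).2 fun i hi => h i (Or.inr hi)]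
      exact hfix a x (h a (Or.inl rfl))

/-! ### The transcendental parameter `ξ = liouvilleNumber 10` -/

/-- `0 < ξ < 1` for `ξ = liouvilleNumber 10 = 0.110001…`. [cite: Mochizuki2012, Rmk 3.4.3 (ii) p.83] -/
theorem liouvilleNumber_ten_bounds : 0 < liouvilleNumber 10 ∧ liouvilleNumber 10 < 1 := by
  have h10 : (1 : ℝ) < 10 := by norm_num
  have hsum := LiouvilleNumber.partialSum_add_remainder h10 0
  have hp : LiouvilleNumber.partialSum 10 0 = 1 / 10 := by
    simp [LiouvilleNumber.partialSum]
  have hr := LiouvilleNumber.remainder_lt' 0 h10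
  have hr0 := LiouvilleNumber.remainder_pos h10 0
  rw [← hsum, hp]
  constructor
  · linarith
  · have : (1 - 1 / (10 : ℝ))⁻¹ * (1 / 10 ^ (0 + 1).factorial) = 1 / 9 := by norm_num
    rw [this] at hr
    linarith

/-- `3 + ξ/10` is NOT algebraic over `ℚ` (`ξ = liouvilleNumber 10` is transcendental).
[cite: Mochizuki2012, Rmk 3.4.3 (ii) p.83] -/
theorem not_isAlgebraic_push_value :
    ¬ IsAlgebraic ℚ ((3 : ℂ) + ((liouvilleNumber 10 / 10 : ℝ) : ℂ)) := by
  intro h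
  have h1 : IsAlgebraic ℚ (((liouvilleNumber 10 / 10 : ℝ) : ℂ)) := by
    have := h.sub (isAlgebraic_algebraMap (3 : ℚ))
    simpa using this
  have h2 : IsAlgebraic ℚ (((liouvilleNumber 10 : ℝ) : ℂ)) := by
    have := h1.mul (isAlgebraic_algebraMap (10 : ℚ))
    have e : (((liouvilleNumber 10 / 10 : ℝ) : ℂ)) * (algebraMap ℚ ℂ 10) =
        ((liouvilleNumber 10 : ℝ) : ℂ) := by
      push_cast
      simp
    rwa [e] at this
  have h3 : IsAlgebraic ℚ (liouvilleNumber 10) :=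
    (isAlgebraic_algebraMap_iff (algebraMap ℝ ℂ).injective).mp h2
  have h4 : IsAlgebraic ℤ (liouvilleNumber 10) := (IsFractionRing.isAlgebraic_iff ℤ ℚ ℝ).mpr h3
  exact transcendental_liouvilleNumber (by norm_num : 2 ≤ 10) h4

/-! ### The planar point-push supported in `B(3, 1/10)` -/

/-- The bump `χ(z) = max(0, 1/10 - ‖z - 3‖)` is `1`-Lipschitz.
[cite: Milnor1965, §4 Homogeneity Lemma] -/
theorem lipschitz_bump : LipschitzWith 1 (fun z : ℂ => max 0 (1/10 - ‖z - 3‖)) := by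
  refine LipschitzWith.of_dist_le_mul fun x y => ?_
  rw [NNReal.coe_one, one_mul, Real.dist_eq, dist_eq_norm]
  calc |max 0 (1/10 - ‖x - 3‖) - max 0 (1/10 - ‖y - 3‖)|
      = |max (1/10 - ‖x - 3‖) 0 - max (1/10 - ‖y - 3‖) 0| := by rw [max_comm 0, max_comm 0]
    _ ≤ |(1/10 - ‖x - 3‖) - (1/10 - ‖y - 3‖)| := abs_max_sub_max_le_abs _ _ _
    _ = |‖y - 3‖ - ‖x - 3‖| := by ring_nf
    _ ≤ ‖(y - 3) - (x - 3)‖ := abs_norm_sub_norm_le _ _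
    _ = ‖x - y‖ := by rw [← norm_neg]; ring_nf

/-- Admissibility of the push vector `ξ`: `1 · ‖ξ‖ < 1`. [cite: Milnor1965, §4 Homogeneity Lemma] -/
theorem push_admissible : (1 : NNReal) * ‖((liouvilleNumber 10 : ℝ) : ℂ)‖₊ < 1 := by
  rw [one_mul, ← NNReal.coe_lt_coe, coe_nnnorm, Complex.norm_real, NNReal.coe_one,
    Real.norm_of_nonneg liouvilleNumber_ten_bounds.1.le]
  exact liouvilleNumber_ten_bounds.2

/-- **The point-push** `β(z) = z + max(0, 1/10 - ‖z - 3‖) · ξ`: a homeomorphism of `ℂ` (tree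
`pointPushHomeomorph`) which (1) is the identity off the open disc `B(3, 1/10)`, together with its
inverse, (2) maps that disc into itself, together with its inverse, and (3) sends `3` to `3 + ξ/10`.
[cite: Milnor1965, §4 Homogeneity Lemma] -/
theorem exists_push :
    ∃ β : ℂ ≃ₜ ℂ, (∀ z, z ∉ ball (3 : ℂ) (1/10) → β z = z ∧ β.symm z = z) ∧
      (∀ z, z ∈ ball (3 : ℂ) (1/10) → β z ∈ ball (3 : ℂ) (1/10) ∧ β.symm z ∈ ball (3 : ℂ) (1/10)) ∧
      β 3 = 3 + ((liouvilleNumber 10 / 10 : ℝ) : ℂ) := by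
  set ξ : ℂ := ((liouvilleNumber 10 : ℝ) : ℂ) with hξ
  have hξn : ‖ξ‖ < 1 := by
    rw [hξ, Complex.norm_real, Real.norm_of_nonneg liouvilleNumber_ten_bounds.1.le]
    exact liouvilleNumber_ten_bounds.2
  let β : ℂ ≃ₜ ℂ := pointPushHomeomorph lipschitz_bump (v := ξ) push_admissible
  have hβ : ∀ z, β z = z + (max 0 (1/10 - ‖z - 3‖) : ℝ) • ξ := fun z => rfl
  -- off the disc the bump vanishes
  have hχ0 : ∀ z, z ∉ ball (3 : ℂ) (1/10) → max 0 (1/10 - ‖z - 3‖) = 0 := fun z hz => by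
    rw [mem_ball, dist_eq_norm, not_lt] at hz
    exact max_eq_left (by linarith)
  have hfix : ∀ z, z ∉ ball (3 : ℂ) (1/10) → β z = z := fun z hz => by
    rw [hβ, hχ0 z hz, zero_smul, add_zero]
  have hfix' : ∀ z, z ∉ ball (3 : ℂ) (1/10) → β.symm z = z := fun z hz =>
    pointPushHomeomorph_symm_apply_of_eq_zero lipschitz_bump push_admissible (hχ0 z hz)
  -- the disc is mapped into itself
  have hin : ∀ z, z ∈ ball (3 : ℂ) (1/10) → β z ∈ ball (3 : ℂ) (1/10) := fun z hz => by
    rw [mem_ball, dist_eq_norm] at hz ⊢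
    rw [hβ]
    have hm : max 0 (1/10 - ‖z - 3‖) = 1/10 - ‖z - 3‖ := max_eq_right (by linarith)
    rw [hm]
    calc ‖z + ((1/10 - ‖z - 3‖ : ℝ) • ξ) - 3‖ = ‖(z - 3) + ((1/10 - ‖z - 3‖ : ℝ) • ξ)‖ := by ring_nf
      _ ≤ ‖z - 3‖ + ‖((1/10 - ‖z - 3‖ : ℝ) • ξ)‖ := norm_add_le _ _
      _ = ‖z - 3‖ + (1/10 - ‖z - 3‖) * ‖ξ‖ := by
          rw [norm_smul, Real.norm_of_nonneg (by linarith)]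
      _ < ‖z - 3‖ + (1/10 - ‖z - 3‖) * 1 := by
          have : 0 < 1/10 - ‖z - 3‖ := by linarith
          nlinarith
      _ = 1/10 := by ring
  have hin' : ∀ z, z ∈ ball (3 : ℂ) (1/10) → β.symm z ∈ ball (3 : ℂ) (1/10) := fun z hz => by
    by_contra h
    have := hfix _ h
    rw [β.apply_symm_apply] at this
    exact h (this ▸ hz)
  refine ⟨β, fun z hz => ⟨hfix z hz, hfix' z hz⟩, fun z hz => ⟨hin z hz, hin' z hz⟩, ?_⟩
  rw [hβ]
  have : max 0 (1/10 - ‖(3 : ℂ) - 3‖) = 1/10 := by norm_num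
  rw [this, hξ, Complex.real_smul]
  push_cast
  ring

include hU in
/-- **Restriction to `U`**: a self-homeomorphism of `ℂ` supported in the disc `B(3, 1/10) ⊆ ℂ ∖ {0,1}`
restricts to a self-homeomorphism of `U` with the same support.
[cite: Milnor1965, §4 Homogeneity Lemma] -/
theorem exists_restrict {β : ℂ ≃ₜ ℂ}
    (hfix : ∀ z, z ∉ ball (3 : ℂ) (1/10) → β z = z ∧ β.symm z = z)
    (hin : ∀ z, z ∈ ball (3 : ℂ) (1/10) → β z ∈ ball (3 : ℂ) (1/10) ∧ β.symm z ∈ ball (3 : ℂ) (1/10)) :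
    ∃ βU : U ≃ₜ U, ∀ x : U, (βU x : ℂ) = β x := by
  have hBU : ball (3 : ℂ) (1/10) ⊆ (U : Set ℂ) := fun z hz => by
    rw [hU]
    rw [mem_ball, dist_eq_norm] at hz
    constructor
    · rintro rfl; norm_num at hz
    · rintro rfl; norm_num at hz
  have hmem : ∀ z ∈ U, β z ∈ U := fun z hz => by
    by_cases hb : z ∈ ball (3 : ℂ) (1/10)
    · exact hBU (hin z hb).1
    · rw [(hfix z hb).1]; exact hz
  have hmem' : ∀ z ∈ U, β.symm z ∈ U := fun z hz => by
    by_cases hb : z ∈ ball (3 : ℂ) (1/10)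
    · exact hBU (hin z hb).2
    · rw [(hfix z hb).2]; exact hz
  exact ⟨{ toFun := fun x => ⟨β x, hmem x x.2⟩
           invFun := fun x => ⟨β.symm x, hmem' x x.2⟩
           left_inv := fun x => Subtype.ext (β.symm_apply_apply _)
           right_inv := fun x => Subtype.ext (β.apply_symm_apply _)
           continuous_toFun := (β.continuous.comp continuous_subtype_val).subtype_mk _
           continuous_invFun := (β.symm.continuous.comp continuous_subtype_val).subtype_mk _ },
    fun x => rfl⟩

end AutHolSpaceNFWitness

end Literature.IUT.HodgeTheaters

end
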